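import Summits.Ventures.LatticeQCDFlow.TrivializingMaps.AbelianTorus

/-!
HONEST FRAMING: exact (Metropolis-corrected) sampling algorithms for lattice gauge theory; figures of
merit are autocorrelation/cost numbers at stated couplings and volumes; no continuum-physics claim.

# AbelianTorusGirth — girth four of the boundary lattice of `(ℤ/L)^d` for `L ≥ 4`, and the SHARP volume-uniform
bound `Torus.locNorm_luscherCoeffs_le_sharp : ∀ d, ∀ L ≥ 4, ∀ k e, N_e(a^{(k)}) ≤ ((d-1)/2)·(6(d-1))^k`
(THEORY-1.md §12.4 / §12.12; closes row R-T1-10b)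

Proposed tree path: `Summits/Ventures/LatticeQCDFlow/TrivializingMaps/AbelianTorusGirth.lean` (OURS). Imports
`AbelianTorus.lean`. Contents: the coordinate-sum functional `csum : (ℤ/L)^d → ℤ/L` (value `±1` on unit
steps; it proves no-loops for `L ≥ 2`, simplicity for `L ≥ 3`, triangle-freeness for `L ≥ 4` without index
case analysis); endpoints `ends e : Sym2`; the lattice divergence `div` and `div (bdry p) = 0`, hence every
element of the boundary lattice is divergence-free (closure induction); the minimum-degree-two step
`exists_adj`; four distinct charged links ⇒ `c(m) = ∑ m_e² ≥ 4` (`four_le_normSq_of_div_eq_zero`);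
`Torus.cycleGirthFour : 4 ≤ L → CycleGirthFour (Torus.complex d L)`; the sharp bound. (For `L = 3` girth
four fails for cycles — a wrapping line — though not for boundaries; not needed.) Kernel-checked: 0 sorries,
axioms {propext, Classical.choice, Quot.sound}. Cell `lqcd-flow`, unit `pub-lqcd-theory1-g3`, 2026-08-21.
-/

namespace Summit.Ventures.LatticeQCDFlow.TrivializingMaps.Abelian

open Finset

noncomputable section

namespace Torus

variable {d L : ℕ}

/-! ### Girth: on `(ℤ/L)^d` with `L ≥ 4` every nonzero element of the boundary lattice has `c(m) ≥ 4` -/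

section Girth

/-- Coordinate sum `∑_i x_i ∈ ℤ/L` — an additive functional taking the value `±1` on every unit step. -/
def csum (x : Site d L) : ZMod L := ∑ i, x i

/-- `csum` is additive. -/
theorem csum_add (x y : Site d L) : csum (x + y) = csum x + csum y := by
  simp [csum, Finset.sum_add_distrib]

/-- `csum (-x) = - csum x`. -/
theorem csum_neg (x : Site d L) : csum (-x) = -csum x := by
  simp [csum, Finset.sum_neg_distrib]

/-- `csum (x - y) = csum x - csum y`. -/
theorem csum_sub (x y : Site d L) : csum (x - y) = csum x - csum y := by
  simp [csum, Finset.sum_sub_distrib]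

/-- `csum ê_μ = 1`. -/
theorem csum_single (μ : Fin d) : csum (Pi.single μ (1 : ZMod L) : Site d L) = 1 := by
  simp [csum, Pi.single_apply]

/-- `(n : ℤ/L) ≠ 0` for `0 < n < L`. -/
theorem natCast_ne_zero {n : ℕ} (hn : 0 < n) (hnL : n < L) : (n : ZMod L) ≠ 0 := by
  intro h
  have hd := (ZMod.natCast_eq_zero_iff n L).1 h
  exact absurd (Nat.le_of_dvd hn hd) (by omega)

/-- `1 ≠ 0` in `ℤ/L` for `L ≥ 2`. -/
theorem one_ne_zero' (hL : 2 ≤ L) : (1 : ZMod L) ≠ 0 := by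
  have := natCast_ne_zero (L := L) (n := 1) one_pos (by omega); simpa using this

/-- `2 ≠ 0` in `ℤ/L` for `L ≥ 3`. -/
theorem two_ne_zero' (hL : 3 ≤ L) : (2 : ZMod L) ≠ 0 := by
  have := natCast_ne_zero (L := L) (n := 2) two_pos (by omega); simpa using this

/-- `3 ≠ 0` in `ℤ/L` for `L ≥ 4`. -/
theorem three_ne_zero' (hL : 4 ≤ L) : (3 : ZMod L) ≠ 0 := by
  have := natCast_ne_zero (L := L) (n := 3) (by norm_num) (by omega); simpa using this

/-- No loops: `x + μ̂ ≠ x` (`L ≥ 2`). -/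
theorem shift_ne (hL : 2 ≤ L) (x : Site d L) (μ : Fin d) : shift x μ ≠ x := by
  intro h
  have h1 : (Pi.single μ (1 : ZMod L) : Site d L) = 0 :=
    add_left_cancel (a := x) (by rw [add_zero]; exact h)
  have h2 := congrArg csum h1
  rw [csum_single] at h2
  exact one_ne_zero' hL (by simpa [csum] using h2)

/-- Unit vectors determine their direction (`L ≥ 2`). -/
theorem single_inj (hL : 2 ≤ L) {μ ν : Fin d}
    (h : (Pi.single μ (1 : ZMod L) : Site d L) = Pi.single ν 1) : μ = ν := by
  by_contra hne
  have := congrFun h μ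
  simp [hne] at this
  exact one_ne_zero' hL this

/-- Two unit vectors never cancel (`L ≥ 3`): the lattice graph is simple. -/
theorem single_add_single_ne_zero (hL : 3 ≤ L) (μ ν : Fin d) :
    (Pi.single μ (1 : ZMod L) : Site d L) + Pi.single ν 1 ≠ 0 := by
  intro h
  have h2 := congrArg csum h
  rw [csum_add, csum_single, csum_single] at h2
  exact two_ne_zero' hL (by simpa [csum] using (by linear_combination h2 : (2 : ZMod L) = csum (0 : Site d L)))

/-- Endpoints `{x, x + μ̂}` of a link, as an unordered pair. -/
def ends (e : Link d L) : Sym2 (Site d L) := s(e.1, shift e.1 e.2)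

/-- Simple graph (`L ≥ 3`): a link is determined by its endpoints. -/
theorem eq_of_ends_eq (hL : 3 ≤ L) {e e' : Link d L} (h : ends e = ends e') : e = e' := by
  obtain ⟨y, μ⟩ := e
  obtain ⟨y', μ'⟩ := e'
  simp only [ends] at h
  rcases Sym2.eq_iff.1 h with ⟨h1, h2⟩ | ⟨h1, h2⟩
  · subst h1
    have h3 : (Pi.single μ (1 : ZMod L) : Site d L) = Pi.single μ' 1 := add_left_cancel (a := y) h2
    rw [single_inj (by omega) h3]
  · exfalso
    subst h1
    have h3 : (Pi.single μ' (1 : ZMod L) : Site d L) + Pi.single μ 1 = 0 := by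
      apply add_left_cancel (a := y')
      rw [add_zero, ← add_assoc]; exact h2
    exact single_add_single_ne_zero hL μ' μ h3

/-- A link with endpoints `{a, b}` is a unit step: `csum (b - a) = ±1`. -/
theorem csum_of_ends_eq {e : Link d L} {a b : Site d L} (h : ends e = s(a, b)) :
    csum (b - a) = 1 ∨ csum (b - a) = -1 := by
  simp only [ends] at h
  rcases Sym2.eq_iff.1 h with ⟨h1, h2⟩ | ⟨h1, h2⟩
  · left; rw [← h2, ← h1, shift, add_sub_cancel_left, csum_single]
  · right; rw [← h1, ← h2, shift, csum_sub, csum_add, csum_single]; ring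

/-- Triangle-free (`L ≥ 4`): no three links with endpoint pairs `{u,v}`, `{v,w}`, `{u,w}`. -/
theorem no_triangle (hL : 4 ≤ L) {e₀ e₁ e₂ : Link d L} {u v w : Site d L}
    (h₀ : ends e₀ = s(u, v)) (h₁ : ends e₁ = s(v, w)) (h₂ : ends e₂ = s(u, w)) : False := by
  have key : csum (w - u) = csum (v - u) + csum (w - v) := by
    rw [← csum_add]; congr 1; abel
  have one_ne := one_ne_zero' (L := L) (by omega)
  have three_ne := three_ne_zero' (L := L) hL
  rcases csum_of_ends_eq h₀ with a | a <;> rcases csum_of_ends_eq h₁ with b | b <;>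
    rcases csum_of_ends_eq h₂ with c | c <;> rw [a, b, c] at key <;>
    first
    | exact one_ne (by linear_combination key)
    | exact one_ne (by linear_combination -key)
    | exact three_ne (by linear_combination key)
    | exact three_ne (by linear_combination -key)

/-- Lattice divergence of an integer 1-chain at a site: out-flow minus in-flow. -/
def div (m : Mode (Link d L)) (v : Site d L) : ℤ :=
  ∑ μ, m (v, μ) - ∑ μ, m (v - Pi.single μ 1, μ)

/-- `div` is additive in the chain. -/
theorem div_add (m m' : Mode (Link d L)) (v : Site d L) : div (m + m') v = div m v + div m' v := by
  simp only [div, Pi.add_apply, Finset.sum_add_distrib]; ring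

/-- `div (-m) = - div m`. -/
theorem div_neg (m : Mode (Link d L)) (v : Site d L) : div (-m) v = -div m v := by
  simp only [div, Pi.neg_apply, Finset.sum_neg_distrib]; ring

/-- `div (m - m') = div m - div m'`. -/
theorem div_sub (m m' : Mode (Link d L)) (v : Site d L) : div (m - m') v = div m v - div m' v := by
  rw [sub_eq_add_neg, div_add, div_neg]; ring

/-- Divergence of a single link indicator: `+1` at its tail, `-1` at its head. -/
theorem div_δ (l : Link d L) (v : Site d L) :
    div (δ l) v = (if v = l.1 then 1 else 0) - (if v = shift l.1 l.2 then 1 else 0) := by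
  obtain ⟨y, ν⟩ := l
  have h1 : ∑ μ, δ (y, ν) (v, μ) = if v = y then 1 else 0 := by
    rw [Finset.sum_eq_single ν]
    · simp [δ_apply]
    · intro μ _ hμ
      rw [δ_apply, if_neg]
      exact fun h => hμ (Prod.ext_iff.1 h).2
    · exact fun h => absurd (Finset.mem_univ _) h
  have h2 : ∑ μ, δ (y, ν) (v - Pi.single μ 1, μ) = if v = shift y ν then 1 else 0 := by
    rw [Finset.sum_eq_single ν]
    · simp [δ_apply, shift, sub_eq_iff_eq_add]
    · intro μ _ hμ
      rw [δ_apply, if_neg]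
      exact fun h => hμ (Prod.ext_iff.1 h).2
    · exact fun h => absurd (Finset.mem_univ _) h
  simp only [div, h1, h2]

/-- Shifts commute. -/
theorem shift_comm (x : Site d L) (μ ν : Fin d) : shift (shift x μ) ν = shift (shift x ν) μ := by
  simp only [shift]; abel

/-- Plaquette boundaries are divergence-free (they are closed walks). -/
theorem div_bdry (p : Plaq d L) (v : Site d L) : div (bdry p) v = 0 := by
  obtain ⟨x, ⟨⟨μ, ν⟩, hμν⟩⟩ := p
  simp only [bdry, div_sub, div_add, div_δ]
  rw [shift_comm x ν μ]
  ring

/-- KEY STEP (minimum degree two): in a divergence-free chain, every endpoint of a charged link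
carries another charged link (`L ≥ 2`: no loops). -/
theorem exists_adj (hL : 2 ≤ L) {m : Mode (Link d L)} (hdiv : ∀ v, div m v = 0) {e : Link d L}
    (he : m e ≠ 0) {w : Site d L} (hw : w ∈ ends e) :
    ∃ e', e' ≠ e ∧ w ∈ ends e' ∧ m e' ≠ 0 := by
  by_contra hcon'
  have hcon : ∀ e', e' ≠ e → w ∈ ends e' → m e' = 0 := by
    intro e' h1 h2
    by_contra h3
    exact hcon' ⟨e', h1, h2, h3⟩
  obtain ⟨y, μ⟩ := e
  have h1 : ∑ ν, m (w, ν) = m (w, μ) := by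
    apply Finset.sum_eq_single μ
    · intro ν _ hν
      apply hcon
      · intro h; exact hν (Prod.ext_iff.1 h).2
      · exact Sym2.mem_iff.2 (Or.inl rfl)
    · intro h; exact absurd (Finset.mem_univ _) h
  have h2 : ∑ ν, m (w - Pi.single ν 1, ν) = m (w - Pi.single μ 1, μ) := by
    apply Finset.sum_eq_single μ
    · intro ν _ hν
      apply hcon
      · intro h; exact hν (Prod.ext_iff.1 h).2
      · exact Sym2.mem_iff.2 (Or.inr (by simp [shift]))
    · intro h; exact absurd (Finset.mem_univ _) h
  have hd := hdiv w
  rw [div, h1, h2] at hd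
  simp only [ends] at hw
  rcases Sym2.mem_iff.1 hw with rfl | rfl
  · -- `w` is the tail of `e`: the in-link `(w - μ̂, μ)` must carry the charge
    have hne : ((w - Pi.single μ 1, μ) : Link d L) ≠ (w, μ) := by
      intro h
      have h' : shift (w - Pi.single μ 1) μ = w - Pi.single μ 1 := by
        have := (Prod.ext_iff.1 h).1
        simp only [shift] at this ⊢
        rw [sub_add_cancel] ; exact this.symm
      exact shift_ne hL _ _ h'
    have h0 := hcon _ hne (Sym2.mem_iff.2 (Or.inr (by simp [shift])))
    exact he (by linarith)
  · -- `w` is the head of `e`: the out-link `(w, μ)` must carry the charge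
    have hne : ((shift y μ, μ) : Link d L) ≠ (y, μ) := by
      intro h; exact shift_ne hL y μ (Prod.ext_iff.1 h).1
    have h0 := hcon _ hne (Sym2.mem_iff.2 (Or.inl rfl))
    have h3 : shift y μ - Pi.single μ 1 = y := by simp [shift]
    rw [h3] at hd
    exact he (by linarith)

variable [NeZero L]

/-- Every element of the boundary lattice `Λ = ⟨χ_p⟩` of the torus is divergence-free. -/
theorem div_eq_zero_of_mem {m : Mode (Link d L)} (hm : m ∈ boundaryLattice (complex d L))
    (v : Site d L) : div m v = 0 := by
  induction hm using AddSubgroup.closure_induction with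
  | mem x hx =>
    obtain ⟨p, rfl⟩ := hx
    exact div_bdry p v
  | zero => simp [div]
  | add x y _ _ hx hy => rw [div_add, hx, hy, add_zero]
  | neg x _ hx => rw [div_neg, hx, neg_zero]

/-- `#supp m ≤ c(m)` for integer modes. -/
theorem card_support_le_normSq (m : Mode (Link d L)) :
    (((Finset.univ.filter fun e => m e ≠ 0).card : ℕ) : ℤ) ≤ normSq m := by
  unfold normSq
  calc (((Finset.univ.filter fun e => m e ≠ 0).card : ℕ) : ℤ)
      = ∑ e ∈ Finset.univ.filter (fun e => m e ≠ 0), (1 : ℤ) := by simp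
    _ ≤ ∑ e ∈ Finset.univ.filter (fun e => m e ≠ 0), m e ^ 2 := by
        refine Finset.sum_le_sum fun e he => ?_
        rw [Finset.mem_filter] at he
        exact (one_le_sq_iff_one_le_abs _).2 (Int.one_le_abs he.2)
    _ ≤ ∑ e, m e ^ 2 := Finset.sum_le_univ_sum_of_nonneg fun e => sq_nonneg _

/-- **Girth four.** On `(ℤ/L)^d` with `L ≥ 4`, a nonzero divergence-free integer 1-chain charges at
least four links, hence `c(m) = ∑ m_e² ≥ 4`: starting from a charged link `{u,v}`, minimum degree two
gives charged links at `v` (towards some `w`) and at `u`, and a further one at `w`; simplicity (`L ≥ 3`)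
and triangle-freeness (`L ≥ 4`) make the four links distinct. (False for `L = 3`: a wrapping line.) -/
theorem four_le_normSq_of_div_eq_zero (hL : 4 ≤ L) {m : Mode (Link d L)}
    (hdiv : ∀ v, div m v = 0) (hm : m ≠ 0) : (4 : ℤ) ≤ normSq m := by
  have hL2 : 2 ≤ L := by omega
  have hL3 : 3 ≤ L := by omega
  obtain ⟨e₀, he₀⟩ : ∃ e, m e ≠ 0 := Function.ne_iff.1 hm
  have hends₀ : ends e₀ = s(e₀.1, shift e₀.1 e₀.2) := rfl
  set u := e₀.1 with hu
  set v := shift e₀.1 e₀.2 with hv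
  have huv : u ≠ v := fun h => shift_ne hL2 _ _ h.symm
  obtain ⟨e₁, hne₁₀, hv₁, he₁⟩ :=
    exists_adj hL2 hdiv he₀ (w := v) (by rw [hends₀]; exact Sym2.mem_mk_right _ _)
  obtain ⟨e₂, hne₂₀, hu₂, he₂⟩ :=
    exists_adj hL2 hdiv he₀ (w := u) (by rw [hends₀]; exact Sym2.mem_mk_left _ _)
  -- the other endpoint `w` of `e₁`
  obtain ⟨w, hw₁, hends₁⟩ : ∃ w, w ∈ ends e₁ ∧ ends e₁ = s(v, w) := by
    have h := hv₁
    simp only [ends] at h ⊢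
    rcases Sym2.mem_iff.1 h with h' | h'
    · exact ⟨shift e₁.1 e₁.2, Sym2.mem_mk_right _ _, by rw [h']⟩
    · exact ⟨e₁.1, Sym2.mem_mk_left _ _, by rw [h', Sym2.eq_swap]⟩
  have hwu : w ≠ u := by
    intro hwu
    apply hne₁₀
    apply eq_of_ends_eq hL3
    rw [hends₁, hends₀, hwu, Sym2.eq_swap]
  have hwv : w ≠ v := by
    intro hwv
    rw [hwv] at hends₁
    simp only [ends] at hends₁
    rcases Sym2.eq_iff.1 hends₁ with ⟨h1, h2⟩ | ⟨h1, h2⟩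
    · exact shift_ne hL2 _ _ (h2.trans h1.symm)
    · exact shift_ne hL2 _ _ (h2.trans h1.symm)
  have hne₁₂ : e₁ ≠ e₂ := by
    intro h
    rw [← h, hends₁] at hu₂
    rcases Sym2.mem_iff.1 hu₂ with h' | h'
    · exact huv h'
    · exact hwu h'.symm
  obtain ⟨e₃, hne₃₁, hw₃, he₃⟩ := exists_adj hL2 hdiv he₁ (w := w) hw₁
  have hne₃₀ : e₃ ≠ e₀ := by
    intro h
    rw [h, hends₀] at hw₃
    rcases Sym2.mem_iff.1 hw₃ with h' | h'
    · exact hwu h'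
    · exact hwv h'
  have hne₃₂ : e₃ ≠ e₂ := by
    intro h
    rw [h] at hw₃
    have hends₂ : ends e₂ = s(u, w) := by
      have := (Sym2.mem_and_mem_iff hwu.symm).1 ⟨hu₂, hw₃⟩
      exact this
    exact no_triangle hL hends₀ hends₁ hends₂
  -- four distinct charged links
  have hsub : ({e₀, e₁, e₂, e₃} : Finset (Link d L)) ⊆ Finset.univ.filter (fun e => m e ≠ 0) := by
    intro e he
    simp only [Finset.mem_insert, Finset.mem_singleton] at he
    rw [Finset.mem_filter]
    refine ⟨Finset.mem_univ _, ?_⟩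
    rcases he with rfl | rfl | rfl | rfl <;> assumption
  have hcard : ({e₀, e₁, e₂, e₃} : Finset (Link d L)).card = 4 := by
    rw [Finset.card_insert_of_notMem, Finset.card_insert_of_notMem, Finset.card_pair hne₃₂.symm]
    · simp only [Finset.mem_insert, Finset.mem_singleton, not_or]
      exact ⟨hne₁₂, hne₃₁.symm⟩
    · simp only [Finset.mem_insert, Finset.mem_singleton, not_or]
      exact ⟨hne₁₀.symm, hne₂₀.symm, hne₃₀.symm⟩
  calc (4 : ℤ) = ((({e₀, e₁, e₂, e₃} : Finset (Link d L)).card : ℕ) : ℤ) := by rw [hcard]; rfl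
    _ ≤ (((Finset.univ.filter fun e => m e ≠ 0).card : ℕ) : ℤ) := by
        exact_mod_cast Finset.card_le_card hsub
    _ ≤ normSq m := card_support_le_normSq m

variable (d L)

/-- **`CycleGirthFour` holds on the torus `(ℤ/L)^d` for every `L ≥ 4`** (THEORY-1 §12.4; row R-T1-10b). -/
theorem cycleGirthFour (hL : 4 ≤ L) : CycleGirthFour (complex d L) := by
  intro m hm hm0
  exact four_le_normSq_of_div_eq_zero hL (fun v => div_eq_zero_of_mem hm v) hm0

/-- **THEOREM A, U(1), sharp torus form** — OURS, PROVED: for every `d`, every `L ≥ 4`, every `k` and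
every link `e` of `(ℤ/L)^d`, `N_e(a^{(k)}) ≤ ((d-1)/2) · (6(d-1))^k`; the right-hand side does not
mention `L`. Radius of the gradient series: `tβ ≥ 1/(6(d-1))` uniformly in the volume. -/
theorem locNorm_luscherCoeffs_le_sharp (hL : 4 ≤ L) (k : ℕ) (e : Link d L) :
    locNorm e (luscherCoeffs (complex d L) k) ≤
      ((2 * (d - 1) : ℕ) : ℝ) / 4 * (3 * ((2 * (d - 1) : ℕ) : ℝ)) ^ k :=
  abelianGeometricGradientBound (complex d L) (cycleGirthFour d L hL) k e

end Girth

end Torus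

end

end Summit.Ventures.LatticeQCDFlow.TrivializingMaps.Abelian
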